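import Literature.AlgebraicGeometry.Resolution.Temkin2008LocalizationProofs
import HarnessLib

/-!
# Crux `PatchingRelPerfect` (stmt-ResolutionOfSingularities-16161), line `closed-point-slice`:
# the roof engine, NON-CLOSED STEP (sub-goal `stub_roofEngineNonClosedStep` of the stub `stub_roofEngine`)

Route `ResolutionOfSingularities/FrobeniusClosing`, crux #6 `PatchingRelPerfect`. The stub
`stub_roofEngine` of the line `closed-point-slice` (skeleton v2.1) runs Temkin's Noetherian
induction (Temkin 2008, proof of Prop. 2.3.4; tree `temkin2008_prop234_of_comp`) on the closed bad
set `C` of an integral fourfold over a perfect field. This file isolates ONE STEP of that induction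
at a MAXIMAL point `x` of `C`, given a desingularization of the local scheme
`X' ×_M Spec 𝒪_{M,x}` (`stub_roofEngineNonClosedStep`: the body of `temkin2008_prop234_of_comp`
between "pick a maximal point" and "the composite is a blow-up", repackaged with the local
desingularization as a hypothesis and the conclusion "every singular point of the new model lies
over `C ∖ {x}`"), together with the point-set lemma that produces NON-CLOSED maximal points:

* `exists_maximal_point_specializes` — every point `c` of a closed subset `C` of a quasi-sober
  `T₀` space has a maximal point of `C` among its generizations (the tree's
  `exists_maximal_point_of_isClosed`, keeping track of `x ⤳ c`);
* `exists_maximal_point_not_isClosed` — hence a closed set with a non-closed point has a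
  non-closed maximal point;
* `stub_roofEngineNonClosedStep` — the step.

## Sources

* M. Temkin, *Desingularization of quasi-excellent schemes in characteristic zero*, Adv. Math.
  219 (2008) 488–522 = arXiv:math/0703678: Lemma 2.1.1 (p. 6), Prop. 2.3.4 and its proof (p. 12,
  arXiv pagination). [Temkin2008]
* U. Görtz, T. Wedhorn, *Algebraic Geometry I* (2nd ed., 2020), Prop. 13.91, (13.19).
  [GortzWedhorn2020]
-/

set_option linter.dupNamespace false -- single-problem summit: doubled namespace component is forced

noncomputable section

open CategoryTheory CategoryTheory.Limits AlgebraicGeometry Literature.AlgebraicGeometry.Resolution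
open TopologicalSpace IsLocalRing

namespace Summit.ResolutionOfSingularities.ResolutionOfSingularities.Theorems

universe u

/-! ## Maximal points of closed sets through a given point -/

/-- In a quasi-sober `T₀` space, every point `c` of a closed subset `C` has a **maximal point of
`C` above it**: a generization `x ⤳ c` in `C` none of whose proper generizations lies in `C` (the
generic point of a maximal irreducible closed subset of `C` through `c`; Temkin's "let `x` be a
maximal point of `X ∖ U`"). In particular if `c` is not a closed point neither is `x`.
[cite: Temkin2008, Prop. 2.3.4 (proof, p. 12)] -/
theorem exists_maximal_point_specializes {α : Type*} [TopologicalSpace α] [QuasiSober α]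
    [T0Space α] {C : Set α} (hC : IsClosed C) {c : α} (hc : c ∈ C) :
    ∃ x ∈ C, x ⤳ c ∧ ∀ y ∈ C, y ⤳ x → y = x := by
  -- adapted from `Literature.AlgebraicGeometry.Resolution.exists_maximal_point_of_isClosed`
  obtain ⟨m, hcm, hm⟩ : ∃ m, ({c} : Set α) ⊆ m ∧
      Maximal (· ∈ {t : Set α | IsPreirreducible t ∧ t ⊆ C}) m := by
    refine zorn_subset_nonempty _ (fun ch hch hchain _ => ?_) {c}
      ⟨isPreirreducible_singleton, Set.singleton_subset_iff.mpr hc⟩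
    refine ⟨⋃₀ ch, ⟨?_, Set.sUnion_subset fun s hs => (hch hs).2⟩,
      fun s hs => Set.subset_sUnion_of_mem hs⟩
    intro u v hu hv ⟨y, hy, hyu⟩ ⟨z, hz, hzv⟩
    obtain ⟨p, hpc, hyp⟩ := Set.mem_sUnion.1 hy
    obtain ⟨q, hqc, hzq⟩ := Set.mem_sUnion.1 hz
    rcases hchain.total hpc hqc with hpq | hqp
    · obtain ⟨w, hwq, hwuv⟩ := (hch hqc).1 u v hu hv ⟨y, hpq hyp, hyu⟩ ⟨z, hzq, hzv⟩
      exact ⟨w, Set.mem_sUnion_of_mem hwq hqc, hwuv⟩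
    · obtain ⟨w, hwp, hwuv⟩ := (hch hpc).1 u v hu hv ⟨y, hyp, hyu⟩ ⟨z, hqp hzq, hzv⟩
      exact ⟨w, Set.mem_sUnion_of_mem hwp hpc, hwuv⟩
  have hm_irr : IsIrreducible m := ⟨⟨c, hcm (Set.mem_singleton c)⟩, hm.prop.1⟩
  have hmC : m ⊆ C := hm.prop.2
  have hm_closed : IsClosed m := by
    have h1 : closure m ∈ {t : Set α | IsPreirreducible t ∧ t ⊆ C} :=
      ⟨isPreirreducible_iff_closure.mpr hm.prop.1, hC.closure_subset_iff.mpr hmC⟩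
    rw [hm.eq_of_subset h1 subset_closure]
    exact isClosed_closure
  have hx : IsGenericPoint hm_irr.genericPoint m := hm_irr.isGenericPoint_genericPoint hm_closed
  refine ⟨hm_irr.genericPoint, hmC hx.mem, hx.specializes (hcm (Set.mem_singleton c)),
    fun y hy hyx => ?_⟩
  have hsub : m ⊆ closure {y} := by
    rw [← hx.def]
    exact closure_minimal (Set.singleton_subset_iff.mpr (specializes_iff_mem_closure.mp hyx))
      isClosed_closure
  have h2 : closure {y} ∈ {t : Set α | IsPreirreducible t ∧ t ⊆ C} :=
    ⟨isPreirreducible_iff_closure.mpr isPreirreducible_singleton,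
      hC.closure_subset_iff.mpr (Set.singleton_subset_iff.mpr hy)⟩
  have heq : m = closure {y} := hm.eq_of_subset h2 hsub
  have hy' : IsGenericPoint y m := by
    rw [heq]
    exact isGenericPoint_closure
  exact hy'.eq hx

/-- A closed subset with a non-closed point has a NON-CLOSED maximal point (a maximal point above
the non-closed point: were it closed it would equal that point). [folklore] -/
theorem exists_maximal_point_not_isClosed {α : Type*} [TopologicalSpace α] [QuasiSober α]
    [T0Space α] {C : Set α} (hC : IsClosed C) {c : α} (hc : c ∈ C)
    (hccl : ¬ IsClosed ({c} : Set α)) :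
    ∃ x ∈ C, ¬ IsClosed ({x} : Set α) ∧ ∀ y ∈ C, y ⤳ x → y = x := by
  obtain ⟨x, hxC, hxc, hmax⟩ := exists_maximal_point_specializes hC hc
  refine ⟨x, hxC, fun hxcl => ?_, hmax⟩
  have : c ∈ closure ({x} : Set α) := hxc.mem_closure
  rw [hxcl.closure_eq, Set.mem_singleton_iff] at this
  exact hccl (this ▸ hxcl)

/-! ## The non-closed step of the roof engine -/

/-- **The roof engine, NON-CLOSED STEP** (sub-goal of the stub `stub_roofEngine`, line
`closed-point-slice`) = ONE STEP of the Noetherian induction in Temkin 2008, proof of Prop. 2.3.4,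
exactly as formalized in `temkin2008_prop234_of_comp`, with the local desingularization at the
maximal bad point `x` supplied as the hypothesis `hloc`. Data: `M` integral of finite type over a
field, `f : X' → M` proper, `X'` regular over `M ∖ C` for a closed `C ∌ η_M`, `x` a maximal
point of `C`, and a desingularization `Bl_𝓘 S' → S'` of the local scheme
`S' = X' ×_M Spec 𝒪_{M,x}` (`𝓘` supported in `S'_sing`). Conclusion: a blowing up
`f' : X'' → X'` along the extension `𝓙` of `𝓘` (Lemma 2.1.1: `Supp 𝓙` is the closure of
`Supp 𝓘`, which lies over `x` since `S'_sing = X'_sing ∩ S'` lies over `C`, over generizations of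
`x`, hence over `x` by maximality; so `f(Supp 𝓙) ⊆ C ∌ η_M`), such that every singular point of
`X''` lies over `C ∖ {x}`: off `C` because `f'` is an isomorphism off `Supp 𝓙 ⊆ f⁻¹(C)` and `X'`
is regular there, not over `x` because `X'' ×_{X'} S' ≅ Bl_𝓘 S'` is regular (flat base change,
uniqueness of blowing ups) and `X'' ×_{X'} S' → X''` identifies local rings.
[cite: Temkin2008, Prop. 2.3.4 (proof, p. 12) and Lemma 2.1.1] -/
theorem stub_roofEngineNonClosedStep {k : Type} [Field k] {M X' : Scheme.{0}}
    (g : M ⟶ Spec (.of k)) [LocallyOfFiniteType g] [QuasiCompact g] [IsIntegral M]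
    (f : X' ⟶ M) [IsProper f] (C : Set M) (hCcl : IsClosed C) (hηC : genericPoint M ∉ C)
    (hreg : ∀ x' : X', f x' ∉ C → x' ∈ Scheme.regularLocus X')
    (x : M) (hxC : x ∈ C) (hmax : ∀ y ∈ C, y ⤳ x → y = x)
    (hloc : Scheme.AdmitsDesingularization (pullback f (M.fromSpecStalk x))) :
    ∃ (X'' : Scheme.{0}) (f' : X'' ⟶ X') (J' : X'.IdealSheafData), IsBlowup f' J' ∧
      genericPoint M ∉ f '' (J'.support : Set X') ∧
      ∀ x'' : X'', x'' ∉ Scheme.regularLocus X'' → f (f' x'') ∈ C ∧ f (f' x'') ≠ x := by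
  -- adapted from `Literature.AlgebraicGeometry.Resolution.temkin2008_prop234_of_comp`
  haveI : IsNoetherian M := Scheme.isNoetherian_of_finiteType_over_field g
  haveI : IsNoetherian X' := Scheme.isNoetherian_of_finiteType_over_field (f ≫ g)
  -- the local scheme `S = Spec 𝒪_{M,x}` and the pro-open pro-subscheme `S' = X' ×_M S` of `X'`
  haveI : Flat (M.fromSpecStalk x) := flat_fromSpecStalk M x
  haveI : IsNoetherian (pullback f (M.fromSpecStalk x)) := {}
  have hfj : ∀ s : ↑(pullback f (M.fromSpecStalk x)),
      f (pullback.fst f (M.fromSpecStalk x) s) =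
        M.fromSpecStalk x (pullback.snd f (M.fromSpecStalk x) s) := fun s => by
    rw [← Scheme.Hom.comp_apply, pullback.condition, Scheme.Hom.comp_apply]
  -- `S'_sing ⊆ g⁻¹(s)`: a singular point of `S'` is singular in `X'`, hence lies over `C`, over a
  -- generization of `x`, hence over `x` by maximality
  have hsing : ∀ s : ↑(pullback f (M.fromSpecStalk x)),
      s ∉ Scheme.regularLocus (pullback f (M.fromSpecStalk x)) →
        pullback.snd f (M.fromSpecStalk x) s = closedPoint (M.presheaf.stalk x) := by
    intro s hs
    have h1 : pullback.fst f (M.fromSpecStalk x) s ∉ Scheme.regularLocus X' := fun h =>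
      hs ((mem_regularLocus_iff_pullback_fst_fromSpecStalk f x s).mpr h)
    have h2 : f (pullback.fst f (M.fromSpecStalk x) s) ∈ C := by
      by_contra h
      exact h1 (hreg _ h)
    have h3 : M.fromSpecStalk x (pullback.snd f (M.fromSpecStalk x) s) ⤳ x :=
      Scheme.range_fromSpecStalk.le ⟨_, rfl⟩
    have h4 : M.fromSpecStalk x (pullback.snd f (M.fromSpecStalk x) s) = x :=
      hmax _ (hfj s ▸ h2) h3
    apply (M.fromSpecStalk x).isEmbedding.injective
    rw [h4, Scheme.fromSpecStalk_closedPoint]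
  -- the local desingularization
  obtain ⟨S'', g', hdes⟩ := hloc
  obtain ⟨I', hg', hI'⟩ := hdes.exists_isBlowup
  have hS''reg := hdes.isRegular
  -- extend its centre to `X'` (Lemma 2.1.1) and blow `X'` up along the extension
  obtain ⟨J', hJ'I', hJ'supp⟩ := exists_idealSheaf_extension_fromSpecStalk f x I'
  obtain ⟨X'', f', hf'⟩ := exists_isBlowup X' J'
  -- the new centre lies over the closure of `x`, inside `C`
  have hIx : ∀ s ∈ (I'.support : Set ↑(pullback f (M.fromSpecStalk x))),
      f (pullback.fst f (M.fromSpecStalk x) s) = x := fun s hs => by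
    rw [hfj, hsing s (hI' hs), Scheme.fromSpecStalk_closedPoint]
  have hJ'C : f '' (J'.support : Set X') ⊆ C := by
    rw [hJ'supp]
    refine (image_closure_subset_closure_image f.continuous).trans ?_
    refine hCcl.closure_subset_iff.mpr ?_
    rintro _ ⟨_, ⟨s, hs, rfl⟩, rfl⟩
    rw [hIx s hs]
    exact hxC
  refine ⟨X'', f', J', hf', fun h => hηC (hJ'C h), fun x'' hx'' => ⟨?_, ?_⟩⟩
  · -- over `M ∖ C`: `X'` is regular there and `f'` is an isomorphism off its centre
    by_contra hy
    have h1 : f' x'' ∈ Scheme.regularLocus X' := hreg _ hy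
    have h2 : f' x'' ∉ (J'.support : Set X') := fun h => hy (hJ'C ⟨_, h, rfl⟩)
    haveI := hf'.isIso_compl
    exact hx'' ((mem_regularLocus_iff_of_isIso_morphismRestrict f'
      ⟨(J'.support : Set X')ᶜ, J'.support.isClosed.isOpen_compl⟩ x'' h2).mpr h1)
  · -- over `x`: `X'' ×_{X'} S'` is the regular scheme `S''` (flat base change, uniqueness)
    intro hyx
    obtain ⟨s, hs⟩ := mem_range_pullback_fst_fromSpecStalk_of_eq f x hyx
    have hT' : IsBlowup (pullback.snd f' (pullback.fst f (M.fromSpecStalk x))) I' := by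
      rw [← hJ'I']
      exact hf'.pullback_snd_of_flat _
    obtain ⟨e, -, -⟩ := hT'.unique hg'
    have hx''range : x'' ∈ Set.range (pullback.fst f' (pullback.fst f (M.fromSpecStalk x))) := by
      rw [Scheme.Pullback.range_fst]
      exact ⟨s, hs⟩
    obtain ⟨t, rfl⟩ := hx''range
    apply hx''
    refine (mem_regularLocus_iff_of_flat_of_isPreimmersion _ t).mp ?_
    exact (mem_regularLocus_iff_of_flat_of_isPreimmersion e.hom t).mpr (hS''reg _)

end Summit.ResolutionOfSingularities.ResolutionOfSingularities.Theorems

end
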